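import Summits.QuantumFields.BalabanUV.Beta.NVertexEvenCarrierTorus

/-!
# `BalabanUV.Beta.NVertexEvenCarrierMatrix` — row D1 ∕ (C1), PART 24: **THE WOUND EVEN N-FAMILY's TORUS WORDS AS MATRIX SUMS OVER PRODUCT INDICES, AND THE `ff` DISPLAY AT
# MATRIX LEVEL** — `perF M (vertex2OfK (AN) N T2Eᵖᵉʳ b₀ b₀′) = Σ_{b : pbox M × Fin 4} Σ_{b′} (Θ_b(b₀)·Θ_{b′}(b₀′)) • perF M (T2Eᵖᵉʳ b b′)`, `perF M (mixOfK (AN) N M2Eᵖᵉʳ b₀ b₀′)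
# = Σ_b Σ_{β : pbox M′ × Fin 4} (Θ_b(b₀)·Ŝ_β(b₀′)) • perF M (M2Eᵖᵉʳ b β)`, and `(perF M (dper M (wound WN♮)))|ff = cE₂ • ½•(ΣΣ ΘΘ′ • Ŵ₂ᵉ|ff + swap) + (ΣΣ ΘŜ′ • ℳ̂₂ᵉ|ff + ΣΣ Θ′Ŝ • ℳ̂₂ᵉ|ff)`
# — the shape in which road FP's v6 display `H₂f := (perF T (dper T 𝒱₂))|ff = Σ_bΣ_{b′} hb hb′ • 𝒯̂₂ + cM₂ • Σ_bΣ_β (hb·hm′ + hb′·hm) • ℳ̂₂` meets the right side term by term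

WHY.  PART 23 §4 displayed v5's `hHN₂` right side per `ff` ENTRY with PART 17's four-fold sums `Σ_{u,κ} Σ_{u′,κ′} Θ·(Θ′·𝒯̂ P Q)`; road FP g45 `TowerHN2Row` v2 consumed it and re-indexed
to product sums inside its proof (`sum_sum_mul_half_symm`, `Fintype.sum_prod_type`).  For v6 the road splits the displayed (J-Λ₂) into a mixed lock `hcM₂` and (J-Λ₂′)
(road A-2 l.67880, an2 A-2∕A-3): the left display `Λ₂ := cM₂ • Σ_bΣ_β (hb v b·hm v′ β + hb v′ b·hm v β) • ℳ̂₂ᵉ(b,β)` is a MATRIX sum over `b : pbox T × Fin 4`, `β : pbox M × Fin 4`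
— so this file states the row's words once in that currency: §1 the bi-vertex and mixed torus words as matrix sums (`Matrix.ext` + PART 23's readers + `Fintype.sum_prod_type`),
§2 the `ff` submatrix of the wound even family as ONE matrix identity (PART 23 §4 entrywise + the same re-indexing).

WHAT ([folklore] re-indexing BY NAME; no `def`, no `def … : Prop`, nothing cited, 0 sorry; letters as PART 23): §1 `perF_vertex2OfK_N_even_eq_sum`, `perF_mixOfK_N_even_eq_sum`;
§2 **`perF_dper_wound_WN_evenHalf_ff_eq`**.
WHAT THIS IS NOT: not the road's `H₂f` display nor the junction; not the locks' values; nothing of Bałaban's asserted, valued or discharged; 0 estimates; 0∕4 row-D1 binders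
(hW, hR, D1Tel, D1Rep); ROOT M‴ p325680 ∕ P5c ∕ D6 untouched; NOT (C1), NOT (T-ID), NOT D1, NEVER «G-an2-4 closed», NOT BetaPertH, NOT continuum, NOT Clay.

HONEST DEPENDENCY (page 1, mandatory): continuum YM on T⁴ ⇐ BetaPertH ∧ nine spine estimates (0/9 proved); BetaPertH ⇐ (D1) ∧ (D4) ∧ CAP+tail;
G-an2-4 gates asym, D1 and NE2/3/4.  HONEST FRAMING (cell contract, verbatim): «discharging `BetaPertH` makes Bałaban's UV stability UNCONDITIONAL —
a real constructive-QFT result; it is NOT the continuum limit and NOT the Clay problem.»  ABSOLUTE RULE (cell charter, verbatim): «No internally-minted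
statement may enter as a cited fact. Every hypothesis is either kernel-proved in this package or a verbatim quotation of a PUBLISHED theorem with page
reference. The manuscript(s) under audit are NOT citable for their own disputed steps — they are the thing under adjudication; programme-internal
(2001/route/tribunal) claims are never citable.»  Row D1 ∕ (C1) OWNER an2 (b2b-balaban-beta-an2) gen 69, 2026-08-27.  No existing file touched.
-/

noncomputable section

open scoped BigOperators

namespace Summit.QuantumFields.BalabanUV.Beta.NVertexEvenCarrierMatrix

open Finset
open Literature.MathematicalPhysics.QuantumFieldTheory
open Literature.MathematicalPhysics.QuantumFieldTheory.Balaban1983to89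
open Literature.MathematicalPhysics.QuantumFieldTheory.Balaban1983to89.Beta
open B4TorusKernel.MultiPeriod (translate)
open B6Lemma24Torus (pbox)
open ExpKernelCalculus (MKer)
open AffineAveraging (Site box)
open OneStepResolventKernel (Fib)
open BalabanStepW2 (M2Of)
open WilsonBiStencil (wilsonW₂)
open SecondOrderResponse (vertex2OfK mixOfK)
open Summit.QuantumFields.BalabanUV.Beta.TameKernelCalculus (trK)
open Summit.QuantumFields.BalabanUV.Beta.BorderedHessian (sgnK)
open Summit.QuantumFields.BalabanUV.Beta.AxialDressingRooted (one_le_of_neZero)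
open Summit.QuantumFields.BalabanUV.Beta.SpineRooted (SpureRecOf T2RecOf)
open Summit.QuantumFields.BalabanUV.Beta.CompositeCorrectorDress (compChart)
open Summit.QuantumFields.BalabanUV.Beta.CompositeOneShotJets (tabsComp)
open Summit.QuantumFields.BalabanUV.Beta.CompositeOneShotJetData (Roots Pins AN WN)
open Summit.QuantumFields.BalabanUV.Beta.FP.KernelPeriodisationFib (Idx perF)
open Summit.QuantumFields.BalabanUV.Beta.FP.KernelPeriodisationFibLoc (dper)
open Summit.QuantumFields.BalabanUV.Beta.FP.TorusGaugeCovariancePairing (wrapPt)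
open Summit.QuantumFields.BalabanUV.Beta.NVertexEvenCarrierTorus (perF_vertex2OfK_N_even perF_mixOfK_N_even perF_dper_wound_WN_evenHalf_inl_inl_eq_sum)

variable {Lc : ℕ} [NeZero Lc] (R : Roots Lc) (P : Pins) (j : ℕ) (M : Fin (3 + 1) → ℕ) [∀ μ, NeZero (M μ)] {M' : Fin (3 + 1) → ℕ}

/-! ## §1 The bi-vertex and mixed torus words as matrix sums over product indices -/

section Words

/-- [folklore] **`perF_vertex2OfK_N_even_eq_sum` — THE EVEN BI-VERTEX TORUS WORD AS A MATRIX SUM**: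
`perF M (vertex2OfK (AN R j) N T2Eᵖᵉʳ μ y ν y′) = Σ_{b : pbox M × Fin 4} Σ_{b′} (Θ_b(μ,y)·Θ_{b′}(ν,y′)) • perF M (T2Eᵖᵉʳ b.2 b.1 b′.2 b′.1)` (PART 23 `perF_vertex2OfK_N_even` + `Fintype.sum_prod_type`). -/
theorem perF_vertex2OfK_N_even_eq_sum (hM : ∀ i, M i = Lc ^ (j + 1) * M' i) (μ : Fin (3 + 1)) (y : Site (3 + 1)) (ν : Fin (3 + 1)) (y' : Site (3 + 1)) :
    perF M (vertex2OfK (AN R j) (Lc ^ (j + 1))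
            (fun κ u κ' u' => dper M (fun x z a c => ∑' n : Site (3 + 1),
            ((1 / 2 : ℝ) • (T2RecOf 3 (Lc ^ (j + 1)) (fun _ => compChart R.rc Lc (j + 1) (R.s (j + 1)) (Lc ^ (j + 1)))
        (SpureRecOf 3 (Lc ^ (j + 1)) (tabsComp (j + 1) (one_le_of_neZero Lc) R.hr (P.cM (j + 1))).V
        (tabsComp (j + 1) (one_le_of_neZero Lc) R.hr (P.cM (j + 1))).H (fun _ => compChart R.rc Lc (j + 1) (R.s (j + 1)) (Lc ^ (j + 1)))
        (P.cE (j + 1)) (P.cVH (j + 1)) (P.cΛ (j + 1)))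
        (tabsComp (j + 1) (one_le_of_neZero Lc) R.hr (P.cM (j + 1))).M (P.cE₂ (j + 1)) (P.cB (j + 1)) (P.T (j + 1))
        (tabsComp (j + 1) (one_le_of_neZero Lc) R.hr (P.cM (j + 1))).vh₂S (tabsComp (j + 1) (one_le_of_neZero Lc) R.hr (P.cM (j + 1))).mixFF 0 κ u κ' (translate M u' n)
          + sgnK (trK (T2RecOf 3 (Lc ^ (j + 1)) (fun _ => compChart R.rc Lc (j + 1) (R.s (j + 1)) (Lc ^ (j + 1)))
        (SpureRecOf 3 (Lc ^ (j + 1)) (tabsComp (j + 1) (one_le_of_neZero Lc) R.hr (P.cM (j + 1))).V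
        (tabsComp (j + 1) (one_le_of_neZero Lc) R.hr (P.cM (j + 1))).H (fun _ => compChart R.rc Lc (j + 1) (R.s (j + 1)) (Lc ^ (j + 1)))
        (P.cE (j + 1)) (P.cVH (j + 1)) (P.cΛ (j + 1)))
        (tabsComp (j + 1) (one_le_of_neZero Lc) R.hr (P.cM (j + 1))).M (P.cE₂ (j + 1)) (P.cB (j + 1)) (P.T (j + 1))
        (tabsComp (j + 1) (one_le_of_neZero Lc) R.hr (P.cM (j + 1))).vh₂S (tabsComp (j + 1) (one_le_of_neZero Lc) R.hr (P.cM (j + 1))).mixFF 0 κ u κ' (translate M u' n))))) x z a c)) μ y ν y')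
      = ∑ b : ↥(pbox M) × Fin (3 + 1), ∑ b' : ↥(pbox M) × Fin (3 + 1),
          (perF M (AN R j) (b.1, Sum.inl b.2) (wrapPt M (((Lc ^ (j + 1) : ℕ) : ℤ) • y), Sum.inr μ) * perF M (AN R j) (b'.1, Sum.inl b'.2) (wrapPt M (((Lc ^ (j + 1) : ℕ) : ℤ) • y'), Sum.inr ν))
            • perF M (dper M (fun x z a c => ∑' n : Site (3 + 1),
            ((1 / 2 : ℝ) • (T2RecOf 3 (Lc ^ (j + 1)) (fun _ => compChart R.rc Lc (j + 1) (R.s (j + 1)) (Lc ^ (j + 1)))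
        (SpureRecOf 3 (Lc ^ (j + 1)) (tabsComp (j + 1) (one_le_of_neZero Lc) R.hr (P.cM (j + 1))).V
        (tabsComp (j + 1) (one_le_of_neZero Lc) R.hr (P.cM (j + 1))).H (fun _ => compChart R.rc Lc (j + 1) (R.s (j + 1)) (Lc ^ (j + 1)))
        (P.cE (j + 1)) (P.cVH (j + 1)) (P.cΛ (j + 1)))
        (tabsComp (j + 1) (one_le_of_neZero Lc) R.hr (P.cM (j + 1))).M (P.cE₂ (j + 1)) (P.cB (j + 1)) (P.T (j + 1))
        (tabsComp (j + 1) (one_le_of_neZero Lc) R.hr (P.cM (j + 1))).vh₂S (tabsComp (j + 1) (one_le_of_neZero Lc) R.hr (P.cM (j + 1))).mixFF 0 b.2 (b.1 : Site (3 + 1)) b'.2 (translate M (b'.1 : Site (3 + 1)) n)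
          + sgnK (trK (T2RecOf 3 (Lc ^ (j + 1)) (fun _ => compChart R.rc Lc (j + 1) (R.s (j + 1)) (Lc ^ (j + 1)))
        (SpureRecOf 3 (Lc ^ (j + 1)) (tabsComp (j + 1) (one_le_of_neZero Lc) R.hr (P.cM (j + 1))).V
        (tabsComp (j + 1) (one_le_of_neZero Lc) R.hr (P.cM (j + 1))).H (fun _ => compChart R.rc Lc (j + 1) (R.s (j + 1)) (Lc ^ (j + 1)))
        (P.cE (j + 1)) (P.cVH (j + 1)) (P.cΛ (j + 1)))
        (tabsComp (j + 1) (one_le_of_neZero Lc) R.hr (P.cM (j + 1))).M (P.cE₂ (j + 1)) (P.cB (j + 1)) (P.T (j + 1))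
        (tabsComp (j + 1) (one_le_of_neZero Lc) R.hr (P.cM (j + 1))).vh₂S (tabsComp (j + 1) (one_le_of_neZero Lc) R.hr (P.cM (j + 1))).mixFF 0 b.2 (b.1 : Site (3 + 1)) b'.2 (translate M (b'.1 : Site (3 + 1)) n))))) x z a c)) := by
  ext X Z
  rw [perF_vertex2OfK_N_even R P j M hM μ y ν y' X Z]
  simp only [Matrix.sum_apply, Matrix.smul_apply, smul_eq_mul, Fintype.sum_prod_type, mul_assoc]

/-- [folklore] **`perF_mixOfK_N_even_eq_sum` — THE EVEN MIXED TORUS WORD AS A MATRIX SUM** (either bond order):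
`perF M (mixOfK (AN R j) N M2Eᵖᵉʳ μ y ν y′) = Σ_{b : pbox M × Fin 4} Σ_{β : pbox M′ × Fin 4} (Θ_b(μ,y)·Ŝ_β(ν,y′)) • perF M (M2Eᵖᵉʳ b.2 b.1 β.2 β.1)` (PART 23 `perF_mixOfK_N_even`). -/
theorem perF_mixOfK_N_even_eq_sum [∀ μ, NeZero (M' μ)] (hM : ∀ i, M i = Lc ^ (j + 1) * M' i) (μ : Fin (3 + 1)) (y : Site (3 + 1)) (ν : Fin (3 + 1)) (y' : Site (3 + 1)) :
    perF M (mixOfK (AN R j) (Lc ^ (j + 1))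
            (fun κ u ρ w => dper M (fun x z a c => ∑' n : Site (3 + 1),
            ((1 / 2 : ℝ) • (M2Of 3 (Lc ^ (j + 1)) (tabsComp (j + 1) (one_le_of_neZero Lc) R.hr (P.cM (j + 1))).mixFF 0 κ u ρ (translate M' w n) + sgnK (trK (M2Of 3 (Lc ^ (j + 1)) (tabsComp (j + 1) (one_le_of_neZero Lc) R.hr (P.cM (j + 1))).mixFF 0 κ u ρ (translate M' w n))))) x z a c)) μ y ν y')
      = ∑ b : ↥(pbox M) × Fin (3 + 1), ∑ β : ↥(pbox M') × Fin (3 + 1),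
          (perF M (AN R j) (b.1, Sum.inl b.2) (wrapPt M (((Lc ^ (j + 1) : ℕ) : ℤ) • y), Sum.inr μ) * perF M (AN R j) (wrapPt M (((Lc ^ (j + 1) : ℕ) : ℤ) • ((β.1 : ↥(pbox M')) : Site (3 + 1))), Sum.inr β.2) (wrapPt M (((Lc ^ (j + 1) : ℕ) : ℤ) • y'), Sum.inr ν))
            • perF M (dper M (fun x z a c => ∑' n : Site (3 + 1),
            ((1 / 2 : ℝ) • (M2Of 3 (Lc ^ (j + 1)) (tabsComp (j + 1) (one_le_of_neZero Lc) R.hr (P.cM (j + 1))).mixFF 0 b.2 (b.1 : Site (3 + 1)) β.2 (translate M' ((β.1 : ↥(pbox M')) : Site (3 + 1)) n) + sgnK (trK (M2Of 3 (Lc ^ (j + 1)) (tabsComp (j + 1) (one_le_of_neZero Lc) R.hr (P.cM (j + 1))).mixFF 0 b.2 (b.1 : Site (3 + 1)) β.2 (translate M' ((β.1 : ↥(pbox M')) : Site (3 + 1)) n))))) x z a c)) := by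
  ext X Z
  rw [perF_mixOfK_N_even R P j M hM μ y ν y' X Z]
  simp only [Matrix.sum_apply, Matrix.smul_apply, smul_eq_mul, Fintype.sum_prod_type, mul_assoc]

end Words

/-! ## §2 The `ff` block of the wound even family as one matrix identity -/

section Display

variable [∀ μ, NeZero (M' μ)]

/-- [folklore] **`perF_dper_wound_WN_evenHalf_ff_eq` — v5's `hHN₂` RIGHT SIDE AS A MATRIX** (`M = Lc^(j+1)·M′`; per box `M := towerTorus …`, `M′ := Mc B`, `j := n+1`):
`(perF M (dper M (x w ↦ Σ'_e WN♮ μ y ν (y′+M′∘e) x w)))|ff = cE₂ • ½•(Σ_bΣ_{b′} (Θ_b(μ,y)·Θ_{b′}(ν,y′)) • Ŵ₂ᵉ(b,b′)|ff + Σ_bΣ_{b′} (Θ_b(ν,y′)·Θ_{b′}(μ,y)) • Ŵ₂ᵉ(b,b′)|ff)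
+ (Σ_bΣ_β (Θ_b(μ,y)·Ŝ_β(ν,y′)) • ℳ̂₂ᵉ(b,β)|ff + Σ_bΣ_β (Θ_b(ν,y′)·Ŝ_β(μ,y)) • ℳ̂₂ᵉ(b,β)|ff)` — PART 23 §4 at every entry, re-indexed to product sums; the currency of road FP's v6 display
`H₂f := Σ_bΣ_{b′} hb hb′ • 𝒯̂₂ + cM₂ • Σ_bΣ_β (hb·hm′ + hb′·hm) • ℳ̂₂`. -/
theorem perF_dper_wound_WN_evenHalf_ff_eq (hM : ∀ i, M i = Lc ^ (j + 1) * M' i) (μ : Fin (3 + 1)) (y : Site (3 + 1)) (ν : Fin (3 + 1)) (y' : Site (3 + 1)) :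
    (perF M (dper M (fun x w a b => ∑' e : Site (3 + 1),
        ((1 / 2 : ℝ) • (WN R P j μ y ν (translate M' y' e) + sgnK (trK (WN R P j μ y ν (translate M' y' e))))) x w a b))).submatrix (fun b : ↥(pbox M) × Fin (3 + 1) => ((b.1, Sum.inl b.2) : Idx M (Fib 3))) (fun b : ↥(pbox M) × Fin (3 + 1) => ((b.1, Sum.inl b.2) : Idx M (Fib 3)))
      = P.cE₂ (j + 1) • ((1 / 2 : ℝ) • (∑ b : ↥(pbox M) × Fin (3 + 1), ∑ b' : ↥(pbox M) × Fin (3 + 1),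
            (perF M (AN R j) (b.1, Sum.inl b.2) (wrapPt M (((Lc ^ (j + 1) : ℕ) : ℤ) • y), Sum.inr μ) * perF M (AN R j) (b'.1, Sum.inl b'.2) (wrapPt M (((Lc ^ (j + 1) : ℕ) : ℤ) • y'), Sum.inr ν))
              • (perF M (dper M (fun x z a c => ∑' n : Site (3 + 1),
            ((1 / 2 : ℝ) • (wilsonW₂ 3 (P.T (j + 1)) b.2 (b.1 : Site (3 + 1)) b'.2 (translate M (b'.1 : Site (3 + 1)) n) + sgnK (trK (wilsonW₂ 3 (P.T (j + 1)) b.2 (b.1 : Site (3 + 1)) b'.2 (translate M (b'.1 : Site (3 + 1)) n))))) x z a c))).submatrix (fun b : ↥(pbox M) × Fin (3 + 1) => ((b.1, Sum.inl b.2) : Idx M (Fib 3))) (fun b : ↥(pbox M) × Fin (3 + 1) => ((b.1, Sum.inl b.2) : Idx M (Fib 3)))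
          + ∑ b : ↥(pbox M) × Fin (3 + 1), ∑ b' : ↥(pbox M) × Fin (3 + 1),
            (perF M (AN R j) (b.1, Sum.inl b.2) (wrapPt M (((Lc ^ (j + 1) : ℕ) : ℤ) • y'), Sum.inr ν) * perF M (AN R j) (b'.1, Sum.inl b'.2) (wrapPt M (((Lc ^ (j + 1) : ℕ) : ℤ) • y), Sum.inr μ))
              • (perF M (dper M (fun x z a c => ∑' n : Site (3 + 1),
            ((1 / 2 : ℝ) • (wilsonW₂ 3 (P.T (j + 1)) b.2 (b.1 : Site (3 + 1)) b'.2 (translate M (b'.1 : Site (3 + 1)) n) + sgnK (trK (wilsonW₂ 3 (P.T (j + 1)) b.2 (b.1 : Site (3 + 1)) b'.2 (translate M (b'.1 : Site (3 + 1)) n))))) x z a c))).submatrix (fun b : ↥(pbox M) × Fin (3 + 1) => ((b.1, Sum.inl b.2) : Idx M (Fib 3))) (fun b : ↥(pbox M) × Fin (3 + 1) => ((b.1, Sum.inl b.2) : Idx M (Fib 3)))))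
        + (∑ b : ↥(pbox M) × Fin (3 + 1), ∑ β : ↥(pbox M') × Fin (3 + 1),
            (perF M (AN R j) (b.1, Sum.inl b.2) (wrapPt M (((Lc ^ (j + 1) : ℕ) : ℤ) • y), Sum.inr μ) * perF M (AN R j) (wrapPt M (((Lc ^ (j + 1) : ℕ) : ℤ) • ((β.1 : ↥(pbox M')) : Site (3 + 1))), Sum.inr β.2) (wrapPt M (((Lc ^ (j + 1) : ℕ) : ℤ) • y'), Sum.inr ν))
              • (perF M (dper M (fun x z a c => ∑' n : Site (3 + 1),
            ((1 / 2 : ℝ) • (M2Of 3 (Lc ^ (j + 1)) (tabsComp (j + 1) (one_le_of_neZero Lc) R.hr (P.cM (j + 1))).mixFF 0 b.2 (b.1 : Site (3 + 1)) β.2 (translate M' ((β.1 : ↥(pbox M')) : Site (3 + 1)) n) + sgnK (trK (M2Of 3 (Lc ^ (j + 1)) (tabsComp (j + 1) (one_le_of_neZero Lc) R.hr (P.cM (j + 1))).mixFF 0 b.2 (b.1 : Site (3 + 1)) β.2 (translate M' ((β.1 : ↥(pbox M')) : Site (3 + 1)) n))))) x z a c))).submatrix (fun b : ↥(pbox M)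 × Fin (3 + 1) => ((b.1, Sum.inl b.2) : Idx M (Fib 3))) (fun b : ↥(pbox M) × Fin (3 + 1) => ((b.1, Sum.inl b.2) : Idx M (Fib 3)))
          + ∑ b : ↥(pbox M) × Fin (3 + 1), ∑ β : ↥(pbox M') × Fin (3 + 1),
            (perF M (AN R j) (b.1, Sum.inl b.2) (wrapPt M (((Lc ^ (j + 1) : ℕ) : ℤ) • y'), Sum.inr ν) * perF M (AN R j) (wrapPt M (((Lc ^ (j + 1) : ℕ) : ℤ) • ((β.1 : ↥(pbox M')) : Site (3 + 1))), Sum.inr β.2) (wrapPt M (((Lc ^ (j + 1) : ℕ) : ℤ) • y), Sum.inr μ))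
              • (perF M (dper M (fun x z a c => ∑' n : Site (3 + 1),
            ((1 / 2 : ℝ) • (M2Of 3 (Lc ^ (j + 1)) (tabsComp (j + 1) (one_le_of_neZero Lc) R.hr (P.cM (j + 1))).mixFF 0 b.2 (b.1 : Site (3 + 1)) β.2 (translate M' ((β.1 : ↥(pbox M')) : Site (3 + 1)) n) + sgnK (trK (M2Of 3 (Lc ^ (j + 1)) (tabsComp (j + 1) (one_le_of_neZero Lc) R.hr (P.cM (j + 1))).mixFF 0 b.2 (b.1 : Site (3 + 1)) β.2 (translate M' ((β.1 : ↥(pbox M')) : Site (3 + 1)) n))))) x z a c))).submatrix (fun b : ↥(pbox M) × Fin (3 + 1) => ((b.1, Sum.inl b.2) : Idx M (Fib 3))) (fun b : ↥(pbox M) × Fin (3 + 1) => ((b.1, Sum.inl b.2) : Idx M (Fib 3)))) := by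
  ext p q
  simp only [Matrix.submatrix_apply, Matrix.add_apply, Matrix.smul_apply, Matrix.sum_apply, smul_eq_mul]
  rw [perF_dper_wound_WN_evenHalf_inl_inl_eq_sum R P j M hM μ y ν y' p.1 q.1 p.2 q.2]
  simp only [Fintype.sum_prod_type, mul_assoc]

end Display

end Summit.QuantumFields.BalabanUV.Beta.NVertexEvenCarrierMatrix

end
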